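import Literature.NumberTheory.Automorphic.Liu2021.Def412AdmissibleIffParity
import Literature.NumberTheory.ComplexMultiplication.CMTypeBasic
import HarnessLib

/-!
# [Liu2021, Def. 4.12] admissibility of a FLIPPED collection for the conjugate and the place-flipped CM type
# (the Rem.-D.5-free arithmetic core of the Case-B companion relabel)

Topic `NumberTheory/Automorphic/Liu2021`; namespace `Literature.NumberTheory.Automorphic.Liu2021.RemD5`.  KERNEL ONLY:
theorems, no definition, no named fact, no `sorry`; ORIENTATION-FREE; **no text of [Liu2021, Rem. D.5] is stated or consumed**.

Setting: a CM field `E` (`K` below) with maximal totally real subfield `F = E⁺`, a CM type `Φ` of `E`, a purely imaginary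
`δ ≠ 0` (the normaliser of the tree's collections `Def411WeilCarriers.epsOf … δ`), `d ∈ F^×` totally negative, and two
collections of local norm classes `ε ε′ : Def411WeilCarriers.Eps F d` that AGREE off a finite set `T` of finite places and
are FLIPPED on `T` (`ε′_v ≠ 1 ↔ ε_v = 1` for `v ∈ T`; at a place where the local class group has two elements this is
`ε′_v ≠ ε_v`).  Write `P(Φ, ε)` for [Liu2021, Def. 4.12] admissibility in the tree's shape
`∃ e, IsAdmissibleElement E Φ e ∧ epsOf … δ e = ε` (★ `isAdmissible_epsOf_iff_even_card`: `P(Φ, ε)` iff `{v : ε_v ≠ 1}` is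
finite and `#{v : ε_v ≠ 1} + #{w : Im φ_w(δ) > 0}` is even, `φ_w` the member of `Φ` above the real place `w`).

* §1 `bar_flip`, `exists_isAdmissibleElement_neg_iff_bar` — the CM-type bookkeeping: `Φ̄` of a flip is the flip of `Φ̄`, and the
  cell's pinned form `∃ e, IsAdmissibleElement Φ e ∧ epsOf δ (−e) = ε` is `P(Φ̄, ε)` (★ `isAdmissibleElement_conj_neg_iff`);
* §2 `card_filter_add_card_filter_bar` (`#{w : Im φ_w(δ) > 0}` for `Φ` and for `Φ̄` add up to the number of real places of `F`),
  `even_card_filter_flip_iff` (flipping `Φ` at one place changes that count by one);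
* §3 `finite_and_even_ncard_flip_iff` (`#{v : ε′_v ≠ 1} ≡ #{v : ε_v ≠ 1} + #T (mod 2)`);
* §4 **`not_isAdmissible_bar_of_flip`**: if `#T + #{real places of F}` is ODD and `P(Φ, ε)`, then `¬ P(Φ̄, ε′)`;
  **`isAdmissible_flip_bar_of_flip`**: under the same hypotheses `P(Φ̄^{(p)}, ε′)` for EVERY embedding `p` (`Φ̄^{(p)}` =
  `CMTypeOps.flip p (bar Φ)`, `Φ̄` with its member at the place of `p` replaced by the conjugate);
* §5 the same in the cell's pinned currency (`epsOf δ (−e)`, parity hypothesis `Even (#T + ([F:ℚ] − 1))` = ★ p751708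
  `RemD5.even_ncard_not_isIsotropic_add_finrank_sub_one`): **`not_isAdmissible_companion_of_flip`**,
  **`isAdmissible_flip_companion_of_flip`**.

Consumer: the d6 line of cell hodgecm-mathlib, `Cruxes/HLiu418/Lines/d6_cm_curve` stub `stub_S1b` (`S1bShape` as typed, WORLD C),
Case B of the companion relabel `(μ, ε) ↦ (μᶜχ̌, ε′)` of [Liu2021, Lem. D.1 (4)] — census `CENSUS-S1b-CaseB-relabel.A-p03g11.md`
d861c608 §4: with `Φ := Φ_μ` pinned as in the registered `_hadm`, `T` the anisotropic set (★ p751016) of parity `[F:ℚ] − 1`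
(★ p751708), §5 says that the companion type `Φ̄_μ` is never admissible for `ε′` while its flip at `ι₁` is — the arithmetic a
[Rem. D.5] text will consume next run.  HC_CM is proved only modulo the 7 printed citations until rung 0 closes; this file proves
no cell binder.

## References
* [Liu2021] Y. Liu, Camb. J. Math. 9 (2021) = arXiv:2102.11518: Def. 4.12 (l. 2102–2108), Rem. 4.4, App. C l. 4550 (CM types ↔
  real places), Lem. D.1 (4) (l. 5235), Rem. D.5 (l. 5396–5405, NOT stated here).
* [Omeara1963] O. T. O'Meara, *Introduction to Quadratic Forms* (1963), §71 Thm. 71:18/71:19 (through ★ `isAdmissible_epsOf_iff_even_card`).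
-/

set_option autoImplicit false

noncomputable section

open NumberField IsDedekindDomain NumberField.InfinitePlace NumberField.ComplexEmbedding
open Literature.AlgebraicGeometry.Liu2021 (IsAdmissibleElement isAdmissibleElement_conj_neg_iff)
open Literature.AlgebraicGeometry.Motives (CMType)
open Literature.NumberTheory.ComplexMultiplication (CMTypeOps.bar CMTypeOps.flip CMTypeOps.placeSet CMTypeOps.mem_bar_iff
  CMTypeOps.mem_flip_iff CMTypeOps.conjugate_mem_iff_notMem CMTypeOps.mem_iff_conjugate_notMem CMTypeOps.mem_or_conjugate_mem
  CMTypeOps.conjugate_mem_placeSet_iff)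

namespace Literature.NumberTheory.Automorphic.Liu2021.RemD5

variable {K : Type} [Field K] [NumberField K] [IsCMField K]

/-! ## §1 CM-type bookkeeping -/

omit [NumberField K] [IsCMField K] in
/-- `Φ̄^{(p)} = (Φ^{(p)})‾`: conjugating a CM type commutes with flipping it at a place. [cite: Liu2021, Rem. 4.4] -/
theorem bar_flip (p : K →+* ℂ) (Φ : CMType K) : CMTypeOps.bar (CMTypeOps.flip p Φ) = CMTypeOps.flip p (CMTypeOps.bar Φ) := by
  apply Subtype.ext
  ext φ
  simp only [CMTypeOps.mem_bar_iff, CMTypeOps.mem_flip_iff]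
  by_cases hA : φ ∈ Φ.1 <;> by_cases hP : φ ∈ CMTypeOps.placeSet p <;> simp [hA, hP]

omit [NumberField K] [IsCMField K] in
/-- As a set, `Φ̄ = {τ | τ̄ ∈ Φ}`. [cite: Liu2021, Rem. 4.4] -/
theorem coe_bar_eq_setOf (Φ : CMType K) : (CMTypeOps.bar Φ).1 = {τ | conjugate τ ∈ Φ.1} :=
  Set.ext fun τ => (CMTypeOps.conjugate_mem_iff_notMem Φ τ).symm

/-- **The cell's pinned admissibility is `P(Φ̄, ·)`**: `(∃ e, e admissible for Φ ∧ epsOf δ (−e) = ε) ↔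
(∃ e, e admissible for Φ̄ ∧ epsOf δ e = ε)` (substitute `e ↦ −e`; `Im τ(−e) < 0 ↔ Im τ̄(e) < 0`).
[cite: Liu2021, Def. 4.12 (l. 2102–2108); Rem. 4.4] -/
theorem exists_isAdmissibleElement_neg_iff_bar (Φ : CMType K) (d : maximalRealSubfield K) (δ : K)
    (ε : Def411WeilCarriers.Eps (maximalRealSubfield K) d) :
    (∃ e : K, IsAdmissibleElement K Φ.1 e ∧ Def411WeilCarriers.epsOf (maximalRealSubfield K) d K δ (-e) = ε) ↔
      ∃ e : K, IsAdmissibleElement K (CMTypeOps.bar Φ).1 e ∧ Def411WeilCarriers.epsOf (maximalRealSubfield K) d K δ e = ε := by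
  constructor
  · rintro ⟨e, he, hε⟩
    refine ⟨-e, ?_, hε⟩
    rw [coe_bar_eq_setOf, isAdmissibleElement_conj_neg_iff]
    exact he
  · rintro ⟨e, he, hε⟩
    refine ⟨-e, ?_, by rw [neg_neg]; exact hε⟩
    have h2 : (CMTypeOps.bar (CMTypeOps.bar Φ)).1 = Φ.1 := by
      change (Φ.1ᶜ)ᶜ = Φ.1
      exact compl_compl Φ.1
    rw [← h2, coe_bar_eq_setOf, isAdmissibleElement_conj_neg_iff]
    exact he

/-! ## §2 The archimedean count `#{w : Im φ_w(δ) > 0}` under `bar` and `flip` -/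

omit [NumberField K] [IsCMField K] in
/-- For the member `φ_w` of `Φ` above `w` (★ `existsUnique_mem_mk_comp_eq`): the filter condition at `w` reads `0 < Im φ_w(δ)`.
[cite: Liu2021, App. C l. 4550] -/
private theorem filterCond_iff (Φ : CMType K) (δ : K) {φw : InfinitePlace (maximalRealSubfield K) → (K →+* ℂ)}
    (hφw : ∀ w, φw w ∈ Φ.1 ∧ InfinitePlace.mk ((φw w).comp (algebraMap (maximalRealSubfield K) K)) = w)
    (huniq : ∀ w (ψ : K →+* ℂ), ψ ∈ Φ.1 ∧ InfinitePlace.mk (ψ.comp (algebraMap (maximalRealSubfield K) K)) = w → ψ = φw w)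
    (w : InfinitePlace (maximalRealSubfield K)) :
    (∃ φ ∈ Φ.1, InfinitePlace.mk (φ.comp (algebraMap (maximalRealSubfield K) K)) = w ∧ 0 < (φ δ).im) ↔ 0 < (φw w δ).im := by
  constructor
  · rintro ⟨φ, hφ, hφw', hpos⟩
    rwa [huniq w φ ⟨hφ, hφw'⟩] at hpos
  · intro hpos
    exact ⟨φw w, (hφw w).1, (hφw w).2, hpos⟩

omit [NumberField K] [IsCMField K] in
/-- The member of `Φ̄` above `w` is the conjugate of the member of `Φ`: the filter condition for `Φ̄` at `w` reads
`0 < Im φ̄_w(δ)`. [cite: Liu2021, App. C l. 4550; Rem. 4.4] -/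
private theorem filterCond_bar_iff (Φ : CMType K) (δ : K) {φw : InfinitePlace (maximalRealSubfield K) → (K →+* ℂ)}
    (hφw : ∀ w, φw w ∈ Φ.1 ∧ InfinitePlace.mk ((φw w).comp (algebraMap (maximalRealSubfield K) K)) = w)
    (huniq : ∀ w (ψ : K →+* ℂ), ψ ∈ Φ.1 ∧ InfinitePlace.mk (ψ.comp (algebraMap (maximalRealSubfield K) K)) = w → ψ = φw w)
    (w : InfinitePlace (maximalRealSubfield K)) :
    (∃ φ ∈ (CMTypeOps.bar Φ).1, InfinitePlace.mk (φ.comp (algebraMap (maximalRealSubfield K) K)) = w ∧ 0 < (φ δ).im) ↔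
      0 < (conjugate (φw w) δ).im := by
  constructor
  · rintro ⟨φ, hφ, hφw', hpos⟩
    rw [CMTypeOps.mem_bar_iff] at hφ
    have hcφ : conjugate φ ∈ Φ.1 := (CMTypeOps.conjugate_mem_iff_notMem Φ φ).2 hφ
    have hmk : InfinitePlace.mk ((conjugate φ).comp (algebraMap (maximalRealSubfield K) K)) = w := by
      rw [conjugate_comp, mk_conjugate_eq, hφw']
    have := huniq w (conjugate φ) ⟨hcφ, hmk⟩
    rw [← this, show conjugate (conjugate φ) = φ from involutive_conjugate K φ]
    exact hpos
  · intro hpos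
    refine ⟨conjugate (φw w), ?_, ?_, hpos⟩
    · rw [CMTypeOps.mem_bar_iff]
      exact (CMTypeOps.mem_iff_conjugate_notMem Φ (φw w)).1 (hφw w).1
    · rw [conjugate_comp, mk_conjugate_eq, (hφw w).2]

omit [NumberField K] [IsCMField K] in
/-- `Im φ̄(δ) = − Im φ(δ)`. [folklore] -/
private theorem im_conjugate_apply (φ : K →+* ℂ) (δ : K) : (conjugate φ δ).im = -(φ δ).im := by
  rw [conjugate_coe_eq, Complex.conj_im]

open scoped Classical in
/-- **`#{w : Im φ_w(δ) > 0 for Φ} + #{w : Im φ_w(δ) > 0 for Φ̄} = #{real places of F}`**: above each real place the member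
of `Φ̄` is the conjugate of the member of `Φ`, and `Im φ(δ) ≠ 0` for `δ` purely imaginary.
[cite: Liu2021, App. C l. 4550; Def. 4.12 (l. 2102–2108)] -/
theorem card_filter_add_card_filter_bar (Φ : CMType K) {δ : K} (hδ : IsCMField.complexConj K δ = -δ) (hδ0 : δ ≠ 0) :
    (Finset.univ.filter fun w : InfinitePlace (maximalRealSubfield K) =>
        ∃ φ ∈ Φ.1, InfinitePlace.mk (φ.comp (algebraMap (maximalRealSubfield K) K)) = w ∧ 0 < (φ δ).im).card +
      (Finset.univ.filter fun w : InfinitePlace (maximalRealSubfield K) =>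
        ∃ φ ∈ (CMTypeOps.bar Φ).1, InfinitePlace.mk (φ.comp (algebraMap (maximalRealSubfield K) K)) = w ∧ 0 < (φ δ).im).card =
      Fintype.card (InfinitePlace (maximalRealSubfield K)) := by
  choose φw hφw huniq using existsUnique_mem_mk_comp_eq Φ
  have h1 : (Finset.univ.filter fun w : InfinitePlace (maximalRealSubfield K) =>
      ∃ φ ∈ Φ.1, InfinitePlace.mk (φ.comp (algebraMap (maximalRealSubfield K) K)) = w ∧ 0 < (φ δ).im) =
      Finset.univ.filter fun w => 0 < (φw w δ).im :=
    Finset.filter_congr fun w _ => filterCond_iff Φ δ hφw huniq w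
  have h2 : (Finset.univ.filter fun w : InfinitePlace (maximalRealSubfield K) =>
      ∃ φ ∈ (CMTypeOps.bar Φ).1, InfinitePlace.mk (φ.comp (algebraMap (maximalRealSubfield K) K)) = w ∧ 0 < (φ δ).im) =
      Finset.univ.filter fun w => ¬ 0 < (φw w δ).im := by
    refine Finset.filter_congr fun w _ => ?_
    rw [filterCond_bar_iff Φ δ hφw huniq w, im_conjugate_apply, neg_pos, not_lt]
    have hne := im_apply_ne_zero_of_complexConj_eq_neg (φw w) hδ hδ0
    exact ⟨fun h => h.le, fun h => lt_of_le_of_ne h hne⟩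
  rw [h1, h2, Finset.card_filter_add_card_filter_not, Finset.card_univ]

open scoped Classical in
/-- **Flipping the CM type at one place changes `#{w : Im φ_w(δ) > 0}` by one**: for every embedding `p`, the count for
`Φ^{(p)} = CMTypeOps.flip p Φ` has the opposite parity of the count for `Φ` (the member above the place of `p` is replaced
by its conjugate, every other member is kept). [cite: Liu2021, App. C l. 4550; Def. 4.12 (l. 2102–2108)] -/
theorem even_card_filter_flip_iff (Φ : CMType K) (p : K →+* ℂ) {δ : K} (hδ : IsCMField.complexConj K δ = -δ) (hδ0 : δ ≠ 0) :
    Even (Finset.univ.filter fun w : InfinitePlace (maximalRealSubfield K) =>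
        ∃ φ ∈ (CMTypeOps.flip p Φ).1, InfinitePlace.mk (φ.comp (algebraMap (maximalRealSubfield K) K)) = w ∧ 0 < (φ δ).im).card ↔
      ¬ Even (Finset.univ.filter fun w : InfinitePlace (maximalRealSubfield K) =>
        ∃ φ ∈ Φ.1, InfinitePlace.mk (φ.comp (algebraMap (maximalRealSubfield K) K)) = w ∧ 0 < (φ δ).im).card := by
  choose φw hφw huniq using existsUnique_mem_mk_comp_eq Φ
  choose φw' hφw' huniq' using existsUnique_mem_mk_comp_eq (CMTypeOps.flip p Φ)
  set wp : InfinitePlace (maximalRealSubfield K) := InfinitePlace.mk (p.comp (algebraMap (maximalRealSubfield K) K)) with hwp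
  -- the member of `Φ` above `wp` lies in `{p, p̄}`
  have hmem_wp : φw wp ∈ CMTypeOps.placeSet p := by
    rcases CMTypeOps.mem_or_conjugate_mem Φ p with hp | hp
    · have := huniq wp p ⟨hp, rfl⟩
      rw [← this]; exact Set.mem_insert _ _
    · have := huniq wp (conjugate p) ⟨hp, by rw [conjugate_comp, mk_conjugate_eq]⟩
      rw [← this]; exact Set.mem_insert_of_mem _ (Set.mem_singleton _)
  -- every embedding in `{p, p̄}` lies above `wp`
  have hplace : ∀ φ ∈ CMTypeOps.placeSet p, InfinitePlace.mk (φ.comp (algebraMap (maximalRealSubfield K) K)) = wp := by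
    intro φ hφ
    rcases hφ with rfl | hφ
    · rfl
    · rw [Set.mem_singleton_iff] at hφ
      rw [hφ, conjugate_comp, mk_conjugate_eq]
  -- (A) off `wp` the members of `Φ^{(p)}` and `Φ` agree
  have hA : ∀ w, w ≠ wp → φw' w = φw w := by
    intro w hw
    have hnot : φw w ∉ CMTypeOps.placeSet p := fun h => hw (by rw [← (hφw w).2, hplace _ h])
    exact (huniq' w (φw w) ⟨(CMTypeOps.mem_flip_iff p Φ _).2 (Or.inl ⟨(hφw w).1, hnot⟩), (hφw w).2⟩).symm ▸ rfl
  -- (B) at `wp` the member of `Φ^{(p)}` is the conjugate of the member of `Φ`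
  have hB : φw' wp = conjugate (φw wp) := by
    symm
    refine huniq' wp (conjugate (φw wp)) ⟨?_, ?_⟩
    · refine (CMTypeOps.mem_flip_iff p Φ _).2 (Or.inr ⟨(CMTypeOps.conjugate_mem_placeSet_iff p _).2 hmem_wp, ?_⟩)
      exact (CMTypeOps.mem_iff_conjugate_notMem Φ (φw wp)).1 (hφw wp).1
    · rw [conjugate_comp, mk_conjugate_eq, (hφw wp).2]
  -- rewrite both counts through the members
  have h1 : (Finset.univ.filter fun w : InfinitePlace (maximalRealSubfield K) =>
      ∃ φ ∈ Φ.1, InfinitePlace.mk (φ.comp (algebraMap (maximalRealSubfield K) K)) = w ∧ 0 < (φ δ).im) =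
      Finset.univ.filter fun w => 0 < (φw w δ).im :=
    Finset.filter_congr fun w _ => filterCond_iff Φ δ hφw huniq w
  have h2 : (Finset.univ.filter fun w : InfinitePlace (maximalRealSubfield K) =>
      ∃ φ ∈ (CMTypeOps.flip p Φ).1, InfinitePlace.mk (φ.comp (algebraMap (maximalRealSubfield K) K)) = w ∧ 0 < (φ δ).im) =
      Finset.univ.filter fun w => 0 < (φw' w δ).im :=
    Finset.filter_congr fun w _ => filterCond_iff (CMTypeOps.flip p Φ) δ hφw' huniq' w
  rw [h1, h2]
  -- split both filters along `w = wp`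
  set S : Finset (InfinitePlace (maximalRealSubfield K)) := Finset.univ.filter fun w => 0 < (φw w δ).im with hS
  set S' : Finset (InfinitePlace (maximalRealSubfield K)) := Finset.univ.filter fun w => 0 < (φw' w δ).im with hS'
  have hsplit : ∀ X : Finset (InfinitePlace (maximalRealSubfield K)),
      X.card = (X.filter fun w => w = wp).card + (X.filter fun w => ¬ w = wp).card :=
    fun X => (Finset.card_filter_add_card_filter_not _).symm
  have hrest : (S.filter fun w => ¬ w = wp) = S'.filter fun w => ¬ w = wp := by
    ext w
    simp only [hS, hS', Finset.mem_filter, Finset.mem_univ, true_and]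
    constructor
    · rintro ⟨h, hw⟩; exact ⟨by rw [hA w hw]; exact h, hw⟩
    · rintro ⟨h, hw⟩; exact ⟨by rw [← hA w hw]; exact h, hw⟩
  have hone : ∀ X : Finset (InfinitePlace (maximalRealSubfield K)),
      (X.filter fun w => w = wp).card = if wp ∈ X then 1 else 0 := by
    intro X
    by_cases h : wp ∈ X
    · rw [if_pos h, Finset.card_eq_one]
      refine ⟨wp, Finset.ext fun w => ?_⟩
      simp only [Finset.mem_filter, Finset.mem_singleton]
      exact ⟨fun hw => hw.2, fun hw => ⟨hw ▸ h, hw⟩⟩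
    · rw [if_neg h, Finset.card_eq_zero, Finset.filter_eq_empty_iff]
      intro w hw hweq
      exact h (hweq ▸ hw)
  have hwpS : wp ∈ S ↔ 0 < (φw wp δ).im := by simp [hS]
  have hwpS' : wp ∈ S' ↔ ¬ 0 < (φw wp δ).im := by
    simp only [hS', Finset.mem_filter, Finset.mem_univ, true_and, hB, im_conjugate_apply, neg_pos, not_lt]
    have hne := im_apply_ne_zero_of_complexConj_eq_neg (φw wp) hδ hδ0
    exact ⟨fun h => h.le, fun h => lt_of_le_of_ne h hne⟩
  rw [hsplit S', hsplit S, hone, hone, ← hrest]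
  by_cases hc : 0 < (φw wp δ).im
  · rw [if_pos (hwpS.2 hc), if_neg (fun h => (hwpS'.1 h) hc), zero_add, add_comm, Nat.even_add_one, not_not]
  · rw [if_neg (fun h => hc (hwpS.1 h)), if_pos (hwpS'.2 hc), zero_add, add_comm, Nat.even_add_one]

/-! ## §3 Flipping the collection on a finite set `T` -/

omit [IsCMField K] in
/-- **`#{v : ε′_v ≠ 1} ≡ #{v : ε_v ≠ 1} + #T (mod 2)`** when `ε′ = ε` off `T` and `ε′_v ≠ 1 ↔ ε_v = 1` on `T`.
[cite: Liu2021, Def. 4.12 (l. 2102–2108); Lem. D.1 (4) (l. 5235)] -/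
theorem finite_and_even_ncard_flip_iff {d : maximalRealSubfield K} (ε ε' : Def411WeilCarriers.Eps (maximalRealSubfield K) d)
    {T : Set (HeightOneSpectrum (𝓞 (maximalRealSubfield K)))} (hT : T.Finite) (hoff : ∀ v ∉ T, ε' v = ε v)
    (hon : ∀ v ∈ T, ε' v ≠ 1 ↔ ε v = 1) (hfin : {v | ε v ≠ 1}.Finite) :
    {v | ε' v ≠ 1}.Finite ∧ (Even {v | ε' v ≠ 1}.ncard ↔ Even ({v | ε v ≠ 1}.ncard + T.ncard)) := by
  set A : Set (HeightOneSpectrum (𝓞 (maximalRealSubfield K))) := {v | ε v ≠ 1} with hA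
  set A' : Set (HeightOneSpectrum (𝓞 (maximalRealSubfield K))) := {v | ε' v ≠ 1} with hA'
  have hsub : A' ⊆ A ∪ T := by
    intro v hv
    by_cases hvT : v ∈ T
    · exact Or.inr hvT
    · left
      change ε v ≠ 1
      rw [← hoff v hvT]
      exact hv
  have hfin' : A'.Finite := (hfin.union hT).subset hsub
  refine ⟨hfin', ?_⟩
  -- `A' \ T = A \ T` and `A' ∩ T = T \ A`
  have hdiff : A' \ T = A \ T := by
    ext v
    simp only [Set.mem_sdiff, hA, hA', Set.mem_setOf_eq]
    constructor
    · rintro ⟨h, hv⟩; exact ⟨by rw [← hoff v hv]; exact h, hv⟩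
    · rintro ⟨h, hv⟩; exact ⟨by rw [hoff v hv]; exact h, hv⟩
  have hinter : A' ∩ T = T \ A := by
    ext v
    simp only [Set.mem_inter_iff, Set.mem_sdiff, hA, hA', Set.mem_setOf_eq, not_not]
    constructor
    · rintro ⟨h, hv⟩; exact ⟨hv, (hon v hv).1 h⟩
    · rintro ⟨hv, h⟩; exact ⟨(hon v hv).2 h, hv⟩
  have e1 := Set.ncard_inter_add_ncard_sdiff_eq_ncard A' T hfin'
  have e2 := Set.ncard_inter_add_ncard_sdiff_eq_ncard A T hfin
  have e3 := Set.ncard_inter_add_ncard_sdiff_eq_ncard T A hT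
  rw [hinter, hdiff] at e1
  rw [Set.inter_comm] at e3
  -- `#A' + #A = 2 #(A \ T) + #T`
  rw [Nat.even_iff, Nat.even_iff]
  omega

/-! ## §4 The two admissibility statements for a general CM type -/

open scoped Classical in
/-- **The conjugate type is never admissible for the flipped collection**: if `#T + #{real places of F}` is odd, `ε` is
`Φ`-admissible in the shape `P(Φ, ε)` and `ε′` is `ε` flipped on `T`, then `ε′` is NOT `Φ̄`-admissible.
[cite: Liu2021, Def. 4.12 (l. 2102–2108); Lem. D.1 (4) (l. 5235)] [cite: Omeara1963, §71 Thm. 71:18] -/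
theorem not_isAdmissible_bar_of_flip (Φ : CMType K) {δ : K} (hδ : IsCMField.complexConj K δ = -δ) (hδ0 : δ ≠ 0)
    (d : maximalRealSubfield K) (hd0 : d ≠ 0)
    (hdneg : ∀ (w : InfinitePlace (maximalRealSubfield K)) (hw : w.IsReal), InfinitePlace.embedding_of_isReal hw d < 0)
    (ε ε' : Def411WeilCarriers.Eps (maximalRealSubfield K) d)
    {T : Set (HeightOneSpectrum (𝓞 (maximalRealSubfield K)))} (hT : T.Finite) (hoff : ∀ v ∉ T, ε' v = ε v)
    (hon : ∀ v ∈ T, ε' v ≠ 1 ↔ ε v = 1) (hpar : Odd (T.ncard + Fintype.card (InfinitePlace (maximalRealSubfield K))))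
    (hadm : ∃ e : K, IsAdmissibleElement K Φ.1 e ∧ Def411WeilCarriers.epsOf (maximalRealSubfield K) d K δ e = ε) :
    ¬ ∃ e : K, IsAdmissibleElement K (CMTypeOps.bar Φ).1 e ∧ Def411WeilCarriers.epsOf (maximalRealSubfield K) d K δ e = ε' := by
  rw [isAdmissible_epsOf_iff_even_card K Φ hδ hδ0 d hd0 hdneg ε] at hadm
  rw [isAdmissible_epsOf_iff_even_card K (CMTypeOps.bar Φ) hδ hδ0 d hd0 hdneg ε']
  obtain ⟨hfin, hev⟩ := hadm
  rintro ⟨-, hev'⟩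
  obtain ⟨-, hflip⟩ := finite_and_even_ncard_flip_iff ε ε' hT hoff hon hfin
  have hsum := card_filter_add_card_filter_bar Φ hδ hδ0
  rw [Nat.even_iff] at hev hev'
  rw [Nat.even_iff, Nat.even_iff] at hflip
  rw [Nat.odd_iff] at hpar
  omega

open scoped Classical in
/-- **The flipped conjugate type IS admissible for the flipped collection**: under the hypotheses of
`not_isAdmissible_bar_of_flip`, for EVERY embedding `p` the collection `ε′` is `Φ̄^{(p)}`-admissible
(`Φ̄^{(p)} = CMTypeOps.flip p (bar Φ)`). [cite: Liu2021, Def. 4.12 (l. 2102–2108); Lem. D.1 (4) (l. 5235)] [cite: Omeara1963, §71 Thm. 71:19] -/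
theorem isAdmissible_flip_bar_of_flip (Φ : CMType K) (p : K →+* ℂ) {δ : K} (hδ : IsCMField.complexConj K δ = -δ) (hδ0 : δ ≠ 0)
    (d : maximalRealSubfield K) (hd0 : d ≠ 0)
    (hdneg : ∀ (w : InfinitePlace (maximalRealSubfield K)) (hw : w.IsReal), InfinitePlace.embedding_of_isReal hw d < 0)
    (ε ε' : Def411WeilCarriers.Eps (maximalRealSubfield K) d)
    {T : Set (HeightOneSpectrum (𝓞 (maximalRealSubfield K)))} (hT : T.Finite) (hoff : ∀ v ∉ T, ε' v = ε v)
    (hon : ∀ v ∈ T, ε' v ≠ 1 ↔ ε v = 1) (hpar : Odd (T.ncard + Fintype.card (InfinitePlace (maximalRealSubfield K))))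
    (hadm : ∃ e : K, IsAdmissibleElement K Φ.1 e ∧ Def411WeilCarriers.epsOf (maximalRealSubfield K) d K δ e = ε) :
    ∃ e : K, IsAdmissibleElement K (CMTypeOps.flip p (CMTypeOps.bar Φ)).1 e ∧
      Def411WeilCarriers.epsOf (maximalRealSubfield K) d K δ e = ε' := by
  rw [isAdmissible_epsOf_iff_even_card K Φ hδ hδ0 d hd0 hdneg ε] at hadm
  rw [isAdmissible_epsOf_iff_even_card K (CMTypeOps.flip p (CMTypeOps.bar Φ)) hδ hδ0 d hd0 hdneg ε']
  obtain ⟨hfin, hev⟩ := hadm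
  obtain ⟨hfin', hflip⟩ := finite_and_even_ncard_flip_iff ε ε' hT hoff hon hfin
  refine ⟨hfin', ?_⟩
  have hsum := card_filter_add_card_filter_bar Φ hδ hδ0
  have hF := even_card_filter_flip_iff (CMTypeOps.bar Φ) p hδ hδ0
  rw [Nat.even_iff] at hev ⊢
  rw [Nat.even_iff, Nat.even_iff] at hflip hF
  rw [Nat.odd_iff] at hpar
  omega

/-! ## §5 The cell's pinned currency (`epsOf δ (−e)`, parity `Even (#T + ([F:ℚ] − 1))`) -/

omit [IsCMField K] in
/-- `#{infinite places of F} = [F : ℚ]` for the totally real `F = E⁺`, as the parity conversion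
`Odd (n + #places) ↔ Even (n + ([F:ℚ] − 1))`. [folklore] -/
private theorem odd_add_card_iff (n : ℕ) :
    Odd (n + Fintype.card (InfinitePlace (maximalRealSubfield K))) ↔ Even (n + (Module.finrank ℚ (maximalRealSubfield K) - 1)) := by
  have hcard : Fintype.card (InfinitePlace (maximalRealSubfield K)) = Module.finrank ℚ (maximalRealSubfield K) := by
    rw [card_eq_nrRealPlaces_add_nrComplexPlaces, IsTotallyReal.nrComplexPlaces_eq_zero, add_zero, ← IsTotallyReal.finrank]
  have hpos : 1 ≤ Module.finrank ℚ (maximalRealSubfield K) := Module.finrank_pos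
  rw [hcard, Nat.odd_iff, Nat.even_iff]
  omega

/-- **Companion type never admissible (cell currency)**: with the pinned shape `∃ e, e admissible for Φ ∧ epsOf δ (−e) = ε` of the
registered `_hadm`, `ε′` the flip of `ε` on a finite `T` with `Even (#T + ([F:ℚ] − 1))` (★ `even_ncard_not_isIsotropic_add_finrank_sub_one`
for the anisotropic set), the CONJUGATE type `Φ̄` (the CM type of the companion label `μᶜ·χ̌`, ★ `cmType_galConj`) is NOT admissible
for `ε′` in the same pinned shape. [cite: Liu2021, Def. 4.12 (l. 2102–2108); Rem. 4.4; Lem. D.1 (4) (l. 5235)] -/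
theorem not_isAdmissible_companion_of_flip (Φ : CMType K) {δ : K} (hδ : IsCMField.complexConj K δ = -δ) (hδ0 : δ ≠ 0)
    (d : maximalRealSubfield K) (hd0 : d ≠ 0)
    (hdneg : ∀ (w : InfinitePlace (maximalRealSubfield K)) (hw : w.IsReal), InfinitePlace.embedding_of_isReal hw d < 0)
    (ε ε' : Def411WeilCarriers.Eps (maximalRealSubfield K) d)
    {T : Set (HeightOneSpectrum (𝓞 (maximalRealSubfield K)))} (hT : T.Finite) (hoff : ∀ v ∉ T, ε' v = ε v)
    (hon : ∀ v ∈ T, ε' v ≠ 1 ↔ ε v = 1) (hpar : Even (T.ncard + (Module.finrank ℚ (maximalRealSubfield K) - 1)))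
    (hadm : ∃ e : K, IsAdmissibleElement K Φ.1 e ∧ Def411WeilCarriers.epsOf (maximalRealSubfield K) d K δ (-e) = ε) :
    ¬ ∃ e : K, IsAdmissibleElement K (CMTypeOps.bar Φ).1 e ∧ Def411WeilCarriers.epsOf (maximalRealSubfield K) d K δ (-e) = ε' := by
  rw [exists_isAdmissibleElement_neg_iff_bar] at hadm ⊢
  exact not_isAdmissible_bar_of_flip (CMTypeOps.bar Φ) hδ hδ0 d hd0 hdneg ε ε' hT hoff hon ((odd_add_card_iff _).2 hpar) hadm

/-- **Flipped companion type admissible (cell currency)**: under the same hypotheses, for EVERY embedding `ι₁` the collection `ε′` IS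
admissible, in the pinned shape, for the companion type flipped at the place of `ι₁`, `CMTypeOps.flip ι₁ (bar Φ)` (= `Φ̄` with `ι₁ ↔ ῑ₁`
exchanged; in Case B, `ι₁ ∉ Φ`, this is «negative at the members of `Φ̄` off `ι₁`, positive at `ι₁`»).
[cite: Liu2021, Def. 4.12 (l. 2102–2108); Rem. 4.4; Lem. D.1 (4) (l. 5235)] -/
theorem isAdmissible_flip_companion_of_flip (Φ : CMType K) (ι₁ : K →+* ℂ) {δ : K} (hδ : IsCMField.complexConj K δ = -δ)
    (hδ0 : δ ≠ 0) (d : maximalRealSubfield K) (hd0 : d ≠ 0)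
    (hdneg : ∀ (w : InfinitePlace (maximalRealSubfield K)) (hw : w.IsReal), InfinitePlace.embedding_of_isReal hw d < 0)
    (ε ε' : Def411WeilCarriers.Eps (maximalRealSubfield K) d)
    {T : Set (HeightOneSpectrum (𝓞 (maximalRealSubfield K)))} (hT : T.Finite) (hoff : ∀ v ∉ T, ε' v = ε v)
    (hon : ∀ v ∈ T, ε' v ≠ 1 ↔ ε v = 1) (hpar : Even (T.ncard + (Module.finrank ℚ (maximalRealSubfield K) - 1)))
    (hadm : ∃ e : K, IsAdmissibleElement K Φ.1 e ∧ Def411WeilCarriers.epsOf (maximalRealSubfield K) d K δ (-e) = ε) :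
    ∃ e : K, IsAdmissibleElement K (CMTypeOps.flip ι₁ (CMTypeOps.bar Φ)).1 e ∧
      Def411WeilCarriers.epsOf (maximalRealSubfield K) d K δ (-e) = ε' := by
  rw [exists_isAdmissibleElement_neg_iff_bar] at hadm ⊢
  rw [bar_flip]
  exact isAdmissible_flip_bar_of_flip (CMTypeOps.bar Φ) ι₁ hδ hδ0 d hd0 hdneg ε ε' hT hoff hon ((odd_add_card_iff _).2 hpar) hadm

end Literature.NumberTheory.Automorphic.Liu2021.RemD5

end
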